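/-
Copyright: the b2b-balaban T⁴-continuum CRUX team, row NE7b leaf lineage `t4-ne7b-formalise-leaf-02` (gen 134). Project licence.
-/
import Summits.QuantumFields.BalabanUV.T4Continuum.Spine.NE7b.AdmissibleFloorLinearPartition
import Summits.QuantumFields.BalabanUV.T4Continuum.Spine.NE7b.TentPartitionTorus

/-!
# THE SEMINORM-IMS FLOOR AT k = 1 WITH PRINT's TENT PARTITION ON THE TORUS: `…AdmissibleFloorLinearPartition.ims_floor_of_linear_partition` with its four
# partition letters DISCHARGED by `…TentPartitionTorus` — `φ_S(c) = Π_ν h((pt c)_ν − (S_ν L + c₀))` ([Balaban1988Convergent] (3.40) p. 275), `μ₀ = 2^d`,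
# `Λ = D√2∕L`, `μ = (a+1)·2^d`; what stays displayed is the term data (`inc`, `R`, `ℓ`, `a`, `b`), the bond-to-site map `pt` with its `ℓ¹`-witnesses of length
# `≤ D`, the local floors `c_loc` on `good`, and `Σ‖T_j x‖² ≤ F x` (row NE7b, node U5c; residual (R2′) family (2), letter (ℓ1); one-`exact` junction)

Cell `pub-balaban`, sub-cell `t4`, spine estimate NE7b (`T4WeightBudget.RelWeightBound`; the cell's OWN estimate — NOT PRINTED in [Bałaban 1983–89],
NOT PROVED).  Crux-route work under `Spine/NE7b/`; NOTHING of Bałaban's estimates is asserted; no `def`; zero `sorry`; no `T4Continuum/Support` leaf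
(FREEZE (0)).  Imports BY NAME: `…AdmissibleFloorLinearPartition` (AFLP, leaf-05 g157: `ims_floor_of_linear_partition`) and `…TentPartitionTorus` (TPTo, this
lineage: `sum_prod_tentZ_eq_one`, `card_alive_prod_tentZ_le`, `hvar_tentZ_torus`, `card_alive_on_term_tentZ_le`).

WHAT IS PROVED ([folklore]): **`ims_floor_of_tent_partition`** — for linear local terms `T_j x = Σ_{c∈inc j} R_{j,c}(x c)` (`‖R_{j,c}v‖ ≤ ℓ‖v‖`, `#inc j ≤ a`,
`#{j : c ∈ inc j} ≤ b`) on bond fields `x : C → W`, bonds read at torus sites `pt : C → (A → ZMod N)` (`N = M·L`, `2 ≤ M`, `0 < L`) with, per term, the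
displacement witness `pt c = pt (ref j) + w⁺ − w⁻`, `Σw⁺ + Σw⁻ ≤ D`; local floors `c_loc` for the normalised tent cutoffs on `good` and `Σ_j‖T_j x‖² ≤ F x`
on `good` ⊢ `((c_loc − (1+t⁻¹)·(a+1)2^d·ℓ²·(2·√(2^d)·D√2∕L)²·a·b)∕(1+t))·Σ_c‖x c‖² ≤ F x`; **`ims_floor_of_tent_partition_unit`** — the plaquette shape:
bonds at the reference site or ONE FORWARD unit move from it (`…PlaquetteTermDisplacement.exists_unit_plaquetteBonds`) ⇒ `Λ = √2∕L`, `μ = 2^d`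
⊢ `((c_loc − (1+t⁻¹)·2^d·ℓ²·(2√(2^d)·√2∕L)²·ab)∕(1+t))·Σ_c‖x c‖² ≤ F x` (d = 4 plaquettes: `E·L² = 2^{11}·24 = 49 152` vs `245 760`).  Toy-free: the
statements are the junction itself.

NOT HERE (honest): the k = 1 TERM DATA (plaquette curls: `a = 4`, `b = 2(d−1)`, `ℓ = 1`, `D = 1`; block averages), the local floors `c_loc` (the (h2)
per-cube gauge letters — CCTL ∕ LGTS ∕ AFI ∕ AFC and the currency ruling Q-leaf05-g157-1), `F` := the full form; anything of Bałaban's estimates.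
BY-NAME EFFECT ON THE WALL: NONE.  NE7b NOT PRINTED ∕ NOT PROVED; spine PROVED 0∕9; rung (B)+1 on ONE finite T⁴ — NOT infinite volume, NOT the mass gap, NOT Clay.
HONEST DEPENDENCY: continuum YM on T⁴ ⇐ BetaPertH ∧ nine spine estimates (0/9 proved); BetaPertH ⇐ (D1) ∧ (D4) ∧ CAP+tail; G-an2-4 gates asym, D1 and NE2/3/4.
-/

set_option autoImplicit false

noncomputable section

open Finset
open Literature.MathematicalPhysics.QuantumFieldTheory.Balaban1983to89.B14.TentUnityTorus (tentZ)
open Summit.QuantumFields.BalabanUV.T4Continuum.NE7b.AdmissibleFloorLinearPartition (ims_floor_of_linear_partition)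
open Summit.QuantumFields.BalabanUV.T4Continuum.NE7b.TentPartitionTorus (sum_prod_tentZ_eq_one card_alive_prod_tentZ_le hvar_tentZ_torus
  card_alive_on_term_tentZ_le card_alive_on_term_tentZ_le_of_unit hdisp_of_unit)

namespace Summit.QuantumFields.BalabanUV.T4Continuum.NE7b.TentPartitionFloor

variable {A : Type*} [Fintype A] [DecidableEq A]
variable {J C : Type*} [Fintype J] [Fintype C]
variable {W V : Type*} [NormedAddCommGroup W] [NormedSpace ℝ W] [NormedAddCommGroup V] [NormedSpace ℝ V]

/-- **THE (h2) FLOOR WITH PRINT's TENT PARTITION ON THE TORUS** — AFLP `ims_floor_of_linear_partition` with `φ_S(c) := Π_ν tentZ L ((pt c)_ν − (S_ν·L + c₀))`,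
`hsum` ∕ `hmult` (`μ₀ = 2^{#A}`) ∕ `hvar` (`Λ = D·√2∕L`) ∕ `hμ` (`μ = (a+1)·2^{#A}`) supplied by `…TentPartitionTorus`. [folklore] -/
theorem ims_floor_of_tent_partition [DecidableEq C] (L M N : ℕ) [NeZero M] [NeZero N] (hL : 0 < L) (hM : 2 ≤ M) (hN : N = M * L) (c₀ : ℕ)
    (inc : J → Finset C) (R : J → C → W →ₗ[ℝ] V) {ℓ : ℝ} (hR : ∀ j c v, ‖R j c v‖ ≤ ℓ * ‖v‖)
    (pt : C → A → ZMod N) (ref : J → C) (D : ℕ)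
    (hdisp : ∀ j, ∀ b ∈ inc j, ∃ wp wm : A → ℕ,
      pt b = pt (ref j) + (fun ν => ((wp ν : ℕ) : ZMod N)) - (fun ν => ((wm ν : ℕ) : ZMod N)) ∧ ∑ ν, wp ν + ∑ ν, wm ν ≤ D)
    {a b : ℕ} (ha : ∀ j, (inc j).card ≤ a) (hb : ∀ c, (Finset.univ.filter fun j => c ∈ inc j).card ≤ b)
    (good : (C → W) → Prop) {cloc : ℝ}
    (hloc : ∀ (S : A → ZMod M) (x : C → W), good x →
      cloc * ∑ c, ‖((∏ ν, tentZ (L : ℝ) (pt c ν - (((S ν).val * L + c₀ : ℕ) : ZMod N))) /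
          Real.sqrt (∑ S' : A → ZMod M, (∏ ν, tentZ (L : ℝ) (pt c ν - (((S' ν).val * L + c₀ : ℕ) : ZMod N))) ^ 2)) • x c‖ ^ 2
        ≤ ∑ j, ‖∑ c ∈ inc j, R j c (((∏ ν, tentZ (L : ℝ) (pt c ν - (((S ν).val * L + c₀ : ℕ) : ZMod N))) /
          Real.sqrt (∑ S' : A → ZMod M, (∏ ν, tentZ (L : ℝ) (pt c ν - (((S' ν).val * L + c₀ : ℕ) : ZMod N))) ^ 2)) • x c)‖ ^ 2)
    (F : (C → W) → ℝ) (hF : ∀ x, good x → ∑ j, ‖∑ c ∈ inc j, R j c (x c)‖ ^ 2 ≤ F x)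
    {t : ℝ} (ht : 0 < t) (x : C → W) (hx : good x) :
    (cloc - (1 + t⁻¹) * ((((a + 1) * 2 ^ Fintype.card A : ℕ) : ℝ) * ℓ ^ 2 *
        (2 * Real.sqrt ((2 ^ Fintype.card A : ℕ) : ℝ) * (D * (Real.sqrt 2 / L))) ^ 2 * a * b)) / (1 + t) * ∑ c, ‖x c‖ ^ 2 ≤ F x :=
  ims_floor_of_linear_partition (ι := A → ZMod M) inc R hR
    (fun (S : A → ZMod M) (c : C) => ∏ ν, tentZ (L : ℝ) (pt c ν - (((S ν).val * L + c₀ : ℕ) : ZMod N)))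
    (fun c => sum_prod_tentZ_eq_one L M N hL hM hN c₀ (pt c))
    (μ₀ := 2 ^ Fintype.card A) (fun c => card_alive_prod_tentZ_le L M N hL hN c₀ (pt c)) ref
    (Λ := D * (Real.sqrt 2 / L)) (by positivity) (hvar_tentZ_torus L M N hL hM hN c₀ pt inc ref D hdisp)
    (μ := (a + 1) * 2 ^ Fintype.card A) (card_alive_on_term_tentZ_le L M N hL hN c₀ pt inc ref ha) ha hb
    good hloc F hF ht x hx


/-- **… WITH UNIT FORWARD DISPLACEMENTS** (the plaquette terms' shape, `…PlaquetteTermDisplacement.exists_unit_plaquetteBonds`): if every bond of a term is read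
at the reference site or ONE FORWARD unit move from it, then `Λ = √2∕L` (`D = 1`, `hdisp_of_unit`) and the term multiplicity drops to `μ = 2^{#A}`
(`card_alive_on_term_tentZ_le_of_unit`) ⊢ `((c_loc − (1+t⁻¹)·2^d·ℓ²·(2√(2^d)·√2∕L)²·ab)∕(1+t))·Σ_c‖x c‖² ≤ F x`. [folklore] -/
theorem ims_floor_of_tent_partition_unit [DecidableEq C] (L M N : ℕ) [NeZero M] [NeZero N] (hL : 0 < L) (hM : 2 ≤ M) (hN : N = M * L) (c₀ : ℕ)
    (inc : J → Finset C) (R : J → C → W →ₗ[ℝ] V) {ℓ : ℝ} (hR : ∀ j c v, ‖R j c v‖ ≤ ℓ * ‖v‖)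
    (pt : C → A → ZMod N) (ref : J → C)
    (hunit : ∀ j, ∀ b ∈ inc j, pt b = pt (ref j) ∨ ∃ ν, pt b = Function.update (pt (ref j)) ν (pt (ref j) ν + 1))
    {a b : ℕ} (ha : ∀ j, (inc j).card ≤ a) (hb : ∀ c, (Finset.univ.filter fun j => c ∈ inc j).card ≤ b)
    (good : (C → W) → Prop) {cloc : ℝ}
    (hloc : ∀ (S : A → ZMod M) (x : C → W), good x →
      cloc * ∑ c, ‖((∏ ν, tentZ (L : ℝ) (pt c ν - (((S ν).val * L + c₀ : ℕ) : ZMod N))) /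
          Real.sqrt (∑ S' : A → ZMod M, (∏ ν, tentZ (L : ℝ) (pt c ν - (((S' ν).val * L + c₀ : ℕ) : ZMod N))) ^ 2)) • x c‖ ^ 2
        ≤ ∑ j, ‖∑ c ∈ inc j, R j c (((∏ ν, tentZ (L : ℝ) (pt c ν - (((S ν).val * L + c₀ : ℕ) : ZMod N))) /
          Real.sqrt (∑ S' : A → ZMod M, (∏ ν, tentZ (L : ℝ) (pt c ν - (((S' ν).val * L + c₀ : ℕ) : ZMod N))) ^ 2)) • x c)‖ ^ 2)
    (F : (C → W) → ℝ) (hF : ∀ x, good x → ∑ j, ‖∑ c ∈ inc j, R j c (x c)‖ ^ 2 ≤ F x)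
    {t : ℝ} (ht : 0 < t) (x : C → W) (hx : good x) :
    (cloc - (1 + t⁻¹) * ((((2 ^ Fintype.card A : ℕ)) : ℝ) * ℓ ^ 2 *
        (2 * Real.sqrt ((2 ^ Fintype.card A : ℕ) : ℝ) * (Real.sqrt 2 / L)) ^ 2 * a * b)) / (1 + t) * ∑ c, ‖x c‖ ^ 2 ≤ F x := by
  have hvar := hvar_tentZ_torus L M N hL hM hN c₀ pt inc ref 1 (hdisp_of_unit pt inc ref hunit)
  simp only [Nat.cast_one, one_mul] at hvar
  exact ims_floor_of_linear_partition (ι := A → ZMod M) inc R hR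
    (fun (S : A → ZMod M) (c : C) => ∏ ν, tentZ (L : ℝ) (pt c ν - (((S ν).val * L + c₀ : ℕ) : ZMod N)))
    (fun c => sum_prod_tentZ_eq_one L M N hL hM hN c₀ (pt c))
    (μ₀ := 2 ^ Fintype.card A) (fun c => card_alive_prod_tentZ_le L M N hL hN c₀ (pt c)) ref
    (Λ := Real.sqrt 2 / L) (by positivity) hvar
    (μ := 2 ^ Fintype.card A) (card_alive_on_term_tentZ_le_of_unit L M N hL hM hN c₀ pt inc ref hunit) ha hb
    good hloc F hF ht x hx

end Summit.QuantumFields.BalabanUV.T4Continuum.NE7b.TentPartitionFloor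

end
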